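import Summits.Parity.GeneralizedHardyLittlewood.Theorems.BeyondDiagonalBeatsQuarter.KernelFormXSqBridge
import HarnessLib

/-!
# Route `PrimeLevelFamEdge`, crux K_B (stmt-Parity-20343), line `diagonal_kernel_split`, prover check C1
# (Mellin-bump lemma), part 1: partial sums of the mollifier weight `W(m) = μ(m)/(mψ(m))` decay like every
# power of `log`

GATE G1 (`Cruxes/BeyondDiagonalBeatsQuarter/GATE-G1-czero.md` §4 (iv), §6 C1) asks for the Mellin-bump lemma
`Σ_{m₁,m₂ ≤ M} (x_{m₁}/m₁)(x_{m₂}/m₂) h(m₁m₂/Y) ≪_{h,k} (log)^{−k}` (`x_m = μ(m)ψ(m)⁻¹(log(M/m)/log M)²`, `h` a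
fixed bump on `(0,∞)`), which discharges `c_dual^{transition}` and `c_dual^{prime−int}` at order `ms`. Its
elementary proof is Abel summation in ONE variable against `A(e) = Σ_{m ≤ e} W(m)`, `W = μ/(id·ψ)` (tree:
`MollifierMainTerm.W = G ∗ Hh`). This file supplies `A(e) ≪_k (1 + log e)^{−k}` for EVERY `k`:
`abs_moebiusDivSum_le k` (`Σ_{j ≤ e} μ(j)/j`, from the tree's de la Vallée-Poussin rate), the `Hh` facts
(`Hh ≥ 0`, multiplicative, prime powers, `Σ_{n ≤ N} Hh(n)√n ≤ C_H` by the Euler product over smooth numbers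
— Mathlib `EulerProduct.summable_and_hasSum_smoothNumbers_prod_primesBelow_tsum` —, tail `≤ C_H/√D`),
Dirichlet's rearrangement `sum_W_eq_sum_Hh_mul`, and **`abs_sum_W_le k`**: `|A(e)| ≤ C_k/(1 + log e)^k`.
Helper toward the heart stub (plan Ω, C1); closes nothing; theorems only; standard axioms.
«The programme SEARCHES and TYPES; no claim about Landau–Siegel zeros, Theorems 1–2 of arXiv:2211.02515 or
a repaired Margin232 until a kernel theorem says so.»
-/

noncomputable section

open scoped Real ArithmeticFunction.Moebius
open Finset ArithmeticFunction

namespace Summit.Parity.GeneralizedHardyLittlewood.Theorems.BeyondDiagonalBeatsQuarter.MellinBump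

open Literature.NumberTheory.LFunctions Literature.NumberTheory.LFunctions.KMV2000
open MollifierMainTerm (W G invA Hh hasSum_Hh W_eq_G_mul_Hh)
open KernelFormXSq

/-! ### Möbius harmonic sums decay like every power of `log` -/

/-- `MM(e) = Σ_{j ≤ e} μ(j)/j ≪_k (1 + log e)^{−k}` for naturals `e ≥ 1`, every `k`
(de la Vallée-Poussin rate of the tree, `e^{−c√log} ≪_k (1+log)^{−k}`). [cite: MontgomeryVaughan2007, §8.1 (8.6)] -/
theorem abs_moebiusDivSum_le (k : ℕ) :
    ∃ C : ℝ, 0 < C ∧ ∀ e : ℕ, 1 ≤ e →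
      |∑ j ∈ Icc 1 e, (μ j : ℝ) / j| ≤ C / (1 + Real.log e) ^ k := by
  obtain ⟨c, hc, C, hC⟩ := abs_sum_moebius_div_le_exp_neg_sqrt_log
  obtain ⟨K, hK, hKb⟩ := exp_neg_sqrt_le_div_pow hc k
  have hC0 : 0 ≤ C := by
    have h := (abs_nonneg _).trans (hC 2 le_rfl)
    exact le_of_not_gt fun hneg ↦ by
      linarith [mul_neg_of_neg_of_pos hneg (Real.exp_pos (-c * Real.sqrt (Real.log 2)))]
  refine ⟨max (C * K) 1, by positivity, fun e he ↦ ?_⟩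
  rcases eq_or_lt_of_le he with rfl | he2
  · simp only [Icc_self, sum_singleton, Nat.cast_one, ArithmeticFunction.moebius_apply_one,
      Int.cast_one, div_one, abs_one, Real.log_one, add_zero, one_pow]
    exact le_max_right _ _
  · have he2' : (2 : ℝ) ≤ e := by exact_mod_cast he2
    have hL : 0 ≤ Real.log e := Real.log_nonneg (by linarith)
    have h := hC e he2'
    rw [Nat.floor_natCast, neg_mul] at h
    have hpow : 0 < (1 + Real.log e) ^ k := by positivity
    calc |∑ j ∈ Icc 1 e, (μ j : ℝ) / j| ≤ C * Real.exp (-(c * Real.sqrt (Real.log e))) := h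
      _ ≤ C * (K / (1 + Real.log e) ^ k) := mul_le_mul_of_nonneg_left (hKb _ hL) hC0
      _ = C * K / (1 + Real.log e) ^ k := by ring
      _ ≤ max (C * K) 1 / (1 + Real.log e) ^ k :=
          div_le_div_of_nonneg_right (le_max_left _ _) hpow.le

/-- `y^{−c} ≤ K_k/(1 + log y)^k` for `y ≥ 1`, `c > 0` (from `e^{−c√L} ≤ K/(1+L)^k` at `L = log²y` and
`(1 + log y)² ≤ 2(1 + log²y)`). [folklore] -/
theorem rpow_neg_le_div_log_pow {c : ℝ} (hc : 0 < c) (k : ℕ) :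
    ∃ K : ℝ, 0 < K ∧ ∀ y : ℝ, 1 ≤ y → y ^ (-c) ≤ K / (1 + Real.log y) ^ k := by
  obtain ⟨K, hK, hKb⟩ := exp_neg_sqrt_le_div_pow hc k
  refine ⟨2 ^ k * K, by positivity, fun y hy ↦ ?_⟩
  have hy0 : 0 < y := by linarith
  have hL : 0 ≤ Real.log y := Real.log_nonneg hy
  have h1 : y ^ (-c) = Real.exp (-(c * Real.sqrt (Real.log y ^ 2))) := by
    rw [Real.sqrt_sq hL, Real.rpow_def_of_pos hy0]; ring_nf
  rw [h1]
  refine (hKb _ (by positivity)).trans ?_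
  have h2 : (1 + Real.log y) ^ 2 ≤ 2 * (1 + Real.log y ^ 2) := by
    nlinarith [sq_nonneg (Real.log y - 1)]
  have h3 : (1 + Real.log y) ^ (2 * k) ≤ 2 ^ k * (1 + Real.log y ^ 2) ^ k := by
    rw [pow_mul, ← mul_pow]; exact pow_le_pow_left₀ (by positivity) h2 k
  have h4 : (1 + Real.log y) ^ k ≤ (1 + Real.log y) ^ (2 * k) :=
    pow_le_pow_right₀ (by linarith) (by omega)
  rw [div_le_div_iff₀ (by positivity) (by positivity)]
  calc K * (1 + Real.log y) ^ k ≤ K * (2 ^ k * (1 + Real.log y ^ 2) ^ k) :=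
        mul_le_mul_of_nonneg_left (h4.trans h3) hK.le
    _ = 2 ^ k * K * (1 + Real.log y ^ 2) ^ k := by ring

/-! ### The convolution factor `Hh(n) = n⁻¹∏_{p ∣ n}(p+1)⁻¹` of `W = G ∗ Hh` -/

/-- Unfolding `Hh(n) = n⁻¹∏_{p∣n}(p+1)⁻¹` for `n ≠ 0`. [folklore] -/
theorem Hh_apply' {n : ℕ} (hn : n ≠ 0) :
    Hh n = (n : ℝ)⁻¹ * ∏ p ∈ n.primeFactors, ((p : ℝ) + 1)⁻¹ := by
  simp [Hh, pmul_apply, prodPrimeFactors_apply hn]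

/-- `Hh ≥ 0`. [folklore] -/
theorem Hh_nonneg' (n : ℕ) : 0 ≤ Hh n := by
  rcases eq_or_ne n 0 with rfl | hn
  · simp
  rw [Hh_apply' hn]
  exact mul_nonneg (by positivity) (Finset.prod_nonneg fun p _ ↦ by positivity)

/-- `Hh` is multiplicative. [folklore] -/
theorem isMultiplicative_Hh' : IsMultiplicative Hh := by
  show IsMultiplicative (invA.pmul (prodPrimeFactors fun p ↦ ((p : ℝ) + 1)⁻¹))
  exact isMultiplicative_invA'.pmul (IsMultiplicative.prodPrimeFactors _)

/-- `Hh(p^i) = p^{−i}(p+1)⁻¹` for `i ≥ 1`. [folklore] -/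
theorem Hh_apply_prime_pow' {p i : ℕ} (hp : p.Prime) (hi : i ≠ 0) :
    Hh (p ^ i) = ((p : ℝ) ^ i)⁻¹ * ((p : ℝ) + 1)⁻¹ := by
  rw [Hh_apply' (pow_ne_zero i hp.ne_zero), Nat.primeFactors_prime_pow hi hp, Finset.prod_singleton]
  push_cast; ring

/-- `Σ_{n ∈ s} Hh(n) ≤ π²/6` for every finite `s` (`Hh ≥ 0`, `Σ_n Hh(n) = ζ(2)`). [folklore] -/
theorem sum_Hh_le (s : Finset ℕ) : ∑ n ∈ s, Hh n ≤ π ^ 2 / 6 :=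
  sum_le_hasSum s (fun n _ ↦ Hh_nonneg' n) hasSum_Hh

/-! ### `Σ_{n ≤ N} Hh(n)√n` is bounded: Euler product over smooth numbers -/

/-- `Hh(n)√n ≥ 0`. [folklore] -/
private theorem f_nonneg (n : ℕ) : 0 ≤ Hh n * (n : ℝ) ^ (1 / 2 : ℝ) :=
  mul_nonneg (Hh_nonneg' n) (by positivity)

/-- `Hh(1)√1 = 1`. [folklore] -/
private theorem f_one : (fun n : ℕ ↦ Hh n * (n : ℝ) ^ (1 / 2 : ℝ)) 1 = 1 := by
  simp [isMultiplicative_Hh'.map_one]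

/-- `n ↦ Hh(n)√n` is multiplicative on coprime arguments. [folklore] -/
private theorem f_mul_of_coprime {m n : ℕ} (h : Nat.Coprime m n) :
    Hh (m * n) * ((m * n : ℕ) : ℝ) ^ (1 / 2 : ℝ) =
      Hh m * (m : ℝ) ^ (1 / 2 : ℝ) * (Hh n * (n : ℝ) ^ (1 / 2 : ℝ)) := by
  simp only [isMultiplicative_Hh'.map_mul_of_coprime h, Nat.cast_mul]
  rw [Real.mul_rpow (by positivity) (by positivity)]; ring

/-- `Hh(p^i)√(p^i) = (p^{−1/2})^i·(p+1)⁻¹` for `i ≥ 1`. [folklore] -/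
private theorem f_prime_pow {p i : ℕ} (hp : p.Prime) (hi : i ≠ 0) :
    Hh (p ^ i) * ((p ^ i : ℕ) : ℝ) ^ (1 / 2 : ℝ) = ((p : ℝ) ^ (-(1 / 2 : ℝ))) ^ i * ((p : ℝ) + 1)⁻¹ := by
  have hp0 : (0 : ℝ) < p := by exact_mod_cast hp.pos
  have hx : (0 : ℝ) < (p : ℝ) ^ i := by positivity
  simp only [Hh_apply_prime_pow' hp hi, Nat.cast_pow]
  have key : ((p : ℝ) ^ i)⁻¹ * ((p : ℝ) ^ i) ^ (1 / 2 : ℝ) = ((p : ℝ) ^ (-(1 / 2 : ℝ))) ^ i := by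
    rw [← Real.rpow_neg_one, ← Real.rpow_add hx, ← Real.rpow_natCast (p : ℝ) i,
      ← Real.rpow_mul hp0.le, ← Real.rpow_natCast ((p : ℝ) ^ (-(1 / 2 : ℝ))) i,
      ← Real.rpow_mul hp0.le]
    norm_num
    ring_nf
  calc ((p : ℝ) ^ i)⁻¹ * ((p : ℝ) + 1)⁻¹ * ((p : ℝ) ^ i) ^ (1 / 2 : ℝ)
      = ((p : ℝ) ^ i)⁻¹ * ((p : ℝ) ^ i) ^ (1 / 2 : ℝ) * ((p : ℝ) + 1)⁻¹ := by ring
    _ = ((p : ℝ) ^ (-(1 / 2 : ℝ))) ^ i * ((p : ℝ) + 1)⁻¹ := by rw [key]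

/-- The local ratio `r = p^{−1/2} ≤ 3/4 < 1` for `p ≥ 2`. [folklore] -/
private theorem rpow_neg_half_le {p : ℕ} (hp : 2 ≤ p) : (p : ℝ) ^ (-(1 / 2 : ℝ)) ≤ 3 / 4 := by
  have hp0 : (0 : ℝ) < p := by positivity
  have hp2 : (2 : ℝ) ≤ p := by exact_mod_cast hp
  rw [Real.rpow_neg hp0.le]
  have h1 : (4 / 3 : ℝ) ≤ (p : ℝ) ^ (1 / 2 : ℝ) := by
    have : (4 / 3 : ℝ) = ((16 / 9 : ℝ)) ^ (1 / 2 : ℝ) := by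
      rw [show (16 / 9 : ℝ) = (4 / 3) ^ 2 by norm_num, ← Real.rpow_natCast,
        ← Real.rpow_mul (by norm_num)]; norm_num
    rw [this]
    exact Real.rpow_le_rpow (by norm_num) (by linarith) (by norm_num)
  calc ((p : ℝ) ^ (1 / 2 : ℝ))⁻¹ ≤ (4 / 3 : ℝ)⁻¹ := inv_anti₀ (by norm_num) h1
    _ = 3 / 4 := by norm_num

/-- The cube bound `p^{−1/2}·(p+1)⁻¹ ≤ p^{−3/2}`. [folklore] -/
private theorem rpow_neg_half_div_le {p : ℕ} (hp : 2 ≤ p) :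
    (p : ℝ) ^ (-(1 / 2 : ℝ)) * ((p : ℝ) + 1)⁻¹ ≤ (p : ℝ) ^ (-(3 / 2 : ℝ)) := by
  have hp0 : (0 : ℝ) < p := by positivity
  have h1 : ((p : ℝ) + 1)⁻¹ ≤ (p : ℝ)⁻¹ := inv_anti₀ hp0 (by linarith)
  have h2 : (p : ℝ) ^ (-(3 / 2 : ℝ)) = (p : ℝ) ^ (-(1 / 2 : ℝ)) * (p : ℝ)⁻¹ := by
    rw [← Real.rpow_neg_one, ← Real.rpow_add hp0]; norm_num
  rw [h2]
  exact mul_le_mul_of_nonneg_left h1 (by positivity)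

/-- Local factor: `Σ_i Hh(p^i)√(p^i) ≤ 1 + 4p^{−3/2}` (geometric series with ratio `p^{−1/2} ≤ 3/4`), and
the local series is absolutely summable. [folklore] -/
private theorem f_local {p : ℕ} (hp : p.Prime) :
    Summable (fun i : ℕ ↦ ‖Hh (p ^ i) * ((p ^ i : ℕ) : ℝ) ^ (1 / 2 : ℝ)‖) ∧
      ∑' i : ℕ, Hh (p ^ i) * ((p ^ i : ℕ) : ℝ) ^ (1 / 2 : ℝ) ≤ 1 + 4 * (p : ℝ) ^ (-(3 / 2 : ℝ)) := by
  have hp0 : (0 : ℝ) < p := by exact_mod_cast hp.pos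
  set r : ℝ := (p : ℝ) ^ (-(1 / 2 : ℝ)) with hr
  have hr0 : 0 ≤ r := by positivity
  have hr1 : r ≤ 3 / 4 := rpow_neg_half_le hp.two_le
  have hr1' : r < 1 := by linarith
  have hle : ∀ i, ‖Hh (p ^ i) * ((p ^ i : ℕ) : ℝ) ^ (1 / 2 : ℝ)‖ ≤ r ^ i := by
    intro i
    rw [Real.norm_of_nonneg (f_nonneg _)]
    rcases eq_or_ne i 0 with rfl | hi
    · simp [isMultiplicative_Hh'.map_one]
    · rw [f_prime_pow hp hi]
      have : ((p : ℝ) + 1)⁻¹ ≤ 1 := inv_le_one_of_one_le₀ (by linarith)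
      calc r ^ i * ((p : ℝ) + 1)⁻¹ ≤ r ^ i * 1 := mul_le_mul_of_nonneg_left this (by positivity)
        _ = r ^ i := mul_one _
  have hsum : Summable (fun i : ℕ ↦ ‖Hh (p ^ i) * ((p ^ i : ℕ) : ℝ) ^ (1 / 2 : ℝ)‖) :=
    Summable.of_nonneg_of_le (fun _ ↦ norm_nonneg _) hle (summable_geometric_of_lt_one hr0 hr1')
  refine ⟨hsum, ?_⟩
  have hs : Summable (fun i : ℕ ↦ Hh (p ^ i) * ((p ^ i : ℕ) : ℝ) ^ (1 / 2 : ℝ)) := hsum.of_norm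
  rw [hs.tsum_eq_zero_add]
  have h0 : Hh (p ^ 0) * ((p ^ 0 : ℕ) : ℝ) ^ (1 / 2 : ℝ) = 1 := by
    simp [isMultiplicative_Hh'.map_one]
  rw [h0]
  have htail : ∀ i : ℕ, Hh (p ^ (i + 1)) * ((p ^ (i + 1) : ℕ) : ℝ) ^ (1 / 2 : ℝ) =
      ((p : ℝ) + 1)⁻¹ * r * r ^ i := by
    intro i; rw [f_prime_pow hp (Nat.succ_ne_zero i), pow_succ]; ring
  simp_rw [htail]
  rw [tsum_mul_left, tsum_geometric_of_lt_one hr0 hr1']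
  have hgeo : (1 - r)⁻¹ ≤ 4 := by
    rw [inv_le_comm₀ (by linarith) (by norm_num)]; linarith
  have hmain : ((p : ℝ) + 1)⁻¹ * r ≤ (p : ℝ) ^ (-(3 / 2 : ℝ)) := by
    rw [mul_comm]; exact rpow_neg_half_div_le hp.two_le
  have : ((p : ℝ) + 1)⁻¹ * r * (1 - r)⁻¹ ≤ (p : ℝ) ^ (-(3 / 2 : ℝ)) * 4 :=
    mul_le_mul hmain hgeo (by positivity) (by positivity)
  linarith

/-- Euler product over `(N+1)`-smooth numbers bounds the partial sums of the non-negative multiplicative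
`n ↦ Hh(n)√n`. [folklore] -/
private theorem sum_f_le_prod (N : ℕ) :
    ∑ n ∈ Icc 1 N, Hh n * (n : ℝ) ^ (1 / 2 : ℝ) ≤
      ∏ p ∈ (N + 1).primesBelow, ∑' i : ℕ, Hh (p ^ i) * ((p ^ i : ℕ) : ℝ) ^ (1 / 2 : ℝ) := by
  have hmul : ∀ {m n : ℕ}, Nat.Coprime m n →
      (fun n : ℕ ↦ Hh n * (n : ℝ) ^ (1 / 2 : ℝ)) (m * n) =
        (fun n : ℕ ↦ Hh n * (n : ℝ) ^ (1 / 2 : ℝ)) m * (fun n : ℕ ↦ Hh n * (n : ℝ) ^ (1 / 2 : ℝ)) n :=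
    fun h ↦ f_mul_of_coprime h
  have hloc : ∀ {p : ℕ}, p.Prime →
      Summable (fun i : ℕ ↦ ‖(fun n : ℕ ↦ Hh n * (n : ℝ) ^ (1 / 2 : ℝ)) (p ^ i)‖) :=
    fun hp ↦ (f_local hp).1
  have hprod := (EulerProduct.summable_and_hasSum_smoothNumbers_prod_primesBelow_tsum
    (f := fun n : ℕ ↦ Hh n * (n : ℝ) ^ (1 / 2 : ℝ)) f_one hmul hloc (N + 1)).2
  have hind : HasSum (((N + 1).smoothNumbers).indicator (fun n : ℕ ↦ Hh n * (n : ℝ) ^ (1 / 2 : ℝ)))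
      (∏ p ∈ (N + 1).primesBelow, ∑' i : ℕ, Hh (p ^ i) * ((p ^ i : ℕ) : ℝ) ^ (1 / 2 : ℝ)) :=
    hasSum_subtype_iff_indicator.mp hprod
  have hnonneg : ∀ n ∉ Icc 1 N,
      0 ≤ ((N + 1).smoothNumbers).indicator (fun n : ℕ ↦ Hh n * (n : ℝ) ^ (1 / 2 : ℝ)) n :=
    fun n _ ↦ Set.indicator_nonneg (fun _ _ ↦ f_nonneg _) _
  have h := sum_le_hasSum (Icc 1 N) hnonneg hind
  refine le_trans (le_of_eq (Finset.sum_congr rfl fun n hn ↦ ?_)) h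
  rw [Finset.mem_Icc] at hn
  rw [Set.indicator_of_mem (Nat.mem_smoothNumbers_of_lt (by omega) (by omega))]

/-- **`Σ_{n ≤ N} Hh(n)√n ≤ C_H`** uniformly in `N` (Euler product over `(N+1)`-smooth numbers:
`∏_p (1 + 4p^{−3/2}) ≤ exp(4 Σ_n n^{−3/2})`). [folklore] -/
theorem sum_Hh_mul_sqrt_le :
    ∃ C : ℝ, 0 < C ∧ ∀ N : ℕ, ∑ n ∈ Icc 1 N, Hh n * (n : ℝ) ^ (1 / 2 : ℝ) ≤ C := by
  have hS : Summable (fun n : ℕ ↦ (n : ℝ) ^ (-(3 / 2 : ℝ))) :=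
    Real.summable_nat_rpow.2 (by norm_num)
  refine ⟨Real.exp (4 * ∑' n : ℕ, (n : ℝ) ^ (-(3 / 2 : ℝ))), Real.exp_pos _, fun N ↦ ?_⟩
  have h1 := sum_f_le_prod N
  have h2 : ∏ p ∈ (N + 1).primesBelow, ∑' i : ℕ, Hh (p ^ i) * ((p ^ i : ℕ) : ℝ) ^ (1 / 2 : ℝ) ≤
      ∏ p ∈ (N + 1).primesBelow, Real.exp (4 * (p : ℝ) ^ (-(3 / 2 : ℝ))) := by
    refine Finset.prod_le_prod (fun p _ ↦ tsum_nonneg fun _ ↦ f_nonneg _) fun p hp ↦ ?_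
    have hpp : p.Prime := (Nat.mem_primesBelow.mp hp).2
    refine (f_local hpp).2.trans ?_
    have := Real.add_one_le_exp (4 * (p : ℝ) ^ (-(3 / 2 : ℝ)))
    linarith
  have h3 : ∏ p ∈ (N + 1).primesBelow, Real.exp (4 * (p : ℝ) ^ (-(3 / 2 : ℝ))) ≤
      Real.exp (4 * ∑' n : ℕ, (n : ℝ) ^ (-(3 / 2 : ℝ))) := by
    rw [← Real.exp_sum, Real.exp_le_exp, ← Finset.mul_sum]
    refine mul_le_mul_of_nonneg_left ?_ (by norm_num)
    exact hS.sum_le_tsum _ (fun n _ ↦ by positivity)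
  exact h1.trans (h2.trans h3)

/-- **Tail:** `Σ_{n ∈ s, D < n} Hh(n) ≤ C_H·D^{−1/2}` for `D ≥ 1`. [folklore] -/
theorem sum_Hh_tail_le :
    ∃ C : ℝ, 0 < C ∧ ∀ N : ℕ, ∀ D : ℝ, 1 ≤ D →
      ∑ n ∈ (Icc 1 N).filter (fun n : ℕ ↦ D < (n : ℝ)), Hh n ≤ C * D ^ (-(1 / 2 : ℝ)) := by
  obtain ⟨C, hC, hCb⟩ := sum_Hh_mul_sqrt_le
  refine ⟨C, hC, fun N D hD ↦ ?_⟩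
  have hD0 : 0 < D := by linarith
  have key : ∀ n ∈ (Icc 1 N).filter (fun n : ℕ ↦ D < (n : ℝ)),
      Hh n ≤ Hh n * (n : ℝ) ^ (1 / 2 : ℝ) * D ^ (-(1 / 2 : ℝ)) := by
    intro n hn
    rw [Finset.mem_filter] at hn
    have hn0 : (0 : ℝ) < n := by linarith
    have h1 : 1 ≤ (n : ℝ) ^ (1 / 2 : ℝ) * D ^ (-(1 / 2 : ℝ)) := by
      rw [Real.rpow_neg hD0.le, ← div_eq_mul_inv, le_div_iff₀ (by positivity), one_mul]
      exact Real.rpow_le_rpow hD0.le hn.2.le (by norm_num)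
    calc Hh n = Hh n * 1 := (mul_one _).symm
      _ ≤ Hh n * ((n : ℝ) ^ (1 / 2 : ℝ) * D ^ (-(1 / 2 : ℝ))) :=
          mul_le_mul_of_nonneg_left h1 (Hh_nonneg' n)
      _ = Hh n * (n : ℝ) ^ (1 / 2 : ℝ) * D ^ (-(1 / 2 : ℝ)) := by ring
  refine (Finset.sum_le_sum key).trans ?_
  rw [← Finset.sum_mul]
  refine mul_le_mul_of_nonneg_right ?_ (by positivity)
  exact (Finset.sum_le_sum_of_subset_of_nonneg (Finset.filter_subset _ _)
    (fun n _ _ ↦ mul_nonneg (Hh_nonneg' n) (by positivity))).trans (hCb N)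

/-! ### Partial sums of `W` -/

/-- **Dirichlet's rearrangement** `Σ_{n ≤ e} W(n) = Σ_{d ≤ e} Hh(d)·Σ_{j ≤ e/d} μ(j)/j` (`W = Hh ∗ G`).
[folklore] -/
theorem sum_W_eq_sum_Hh_mul (e : ℕ) :
    ∑ n ∈ Icc 1 e, W n = ∑ d ∈ Icc 1 e, Hh d * ∑ j ∈ Icc 1 (e / d), (μ j : ℝ) / j := by
  rw [W_eq_G_mul_Hh, mul_comm G Hh, Literature.Barriers.Parity.Icc_one_eq_Ioc_zero]
  have h1 : ∑ n ∈ Ioc 0 e, (Hh * G) n = ∑ n ∈ Ioc 0 e, ∑ x ∈ n.divisorsAntidiagonal, Hh x.1 * G x.2 :=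
    Finset.sum_congr rfl fun n _ ↦ by rw [mul_apply]
  rw [h1, SiegelWalfiszLiouville.sum_Ioc_sum_divisorsAntidiagonal_eq
    (fun a b ↦ Hh a * G b) e]
  refine Finset.sum_congr rfl fun d _ ↦ ?_
  rw [Finset.mul_sum, Literature.Barriers.Parity.Icc_one_eq_Ioc_zero]
  refine Finset.sum_congr rfl fun j _ ↦ ?_
  rw [G_apply', div_eq_mul_inv]

/-- **`A(e) = Σ_{m ≤ e} μ(m)/(mψ(m)) ≪_k (1 + log e)^{−k}`** for naturals `e ≥ 1`, every `k`: split the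
rearrangement at `d = √e` — small `d` see `MM(e/d) ≪ (1 + log e)^{−k}`, large `d` carry the tail weight
`d^{1/2}e^{−1/4}`, summed with `Σ Hh(d)√d ≤ C_H`. [cite: MontgomeryVaughan2007, §8.1 (8.6) — derivation] -/
theorem abs_sum_W_le (k : ℕ) :
    ∃ C : ℝ, 0 < C ∧ ∀ e : ℕ, 1 ≤ e → |∑ n ∈ Icc 1 e, W n| ≤ C / (1 + Real.log e) ^ k := by
  obtain ⟨C₁, hC₁, hMM⟩ := abs_moebiusDivSum_le k
  obtain ⟨C₂, hC₂, hH⟩ := sum_Hh_mul_sqrt_le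
  obtain ⟨K, hK, hKb⟩ := rpow_neg_le_div_log_pow (by norm_num : (0 : ℝ) < 1 / 4) k
  refine ⟨4 ^ k * C₁ * (π ^ 2 / 6) + C₁ * C₂ * K, by positivity, fun e he ↦ ?_⟩
  have he0 : (0 : ℝ) < e := by exact_mod_cast he
  have he1 : (1 : ℝ) ≤ e := by exact_mod_cast he
  have hL : 0 ≤ Real.log e := Real.log_nonneg he1
  set L : ℝ := 1 + Real.log e with hLdef
  have hL1 : 1 ≤ L := by rw [hLdef]; linarith
  rw [sum_W_eq_sum_Hh_mul]
  have hterm : ∀ d ∈ Icc 1 e, |Hh d * ∑ j ∈ Icc 1 (e / d), (μ j : ℝ) / j| ≤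
      Hh d * (4 ^ k * C₁ / L ^ k) + Hh d * (d : ℝ) ^ (1 / 2 : ℝ) * (C₁ * (e : ℝ) ^ (-(1 / 4 : ℝ))) := by
    intro d hd
    rw [Finset.mem_Icc] at hd
    have hd0 : (0 : ℝ) < d := by exact_mod_cast hd.1
    have hed : 1 ≤ e / d := (Nat.one_le_div_iff hd.1).2 hd.2
    rw [abs_mul, abs_of_nonneg (Hh_nonneg' d)]
    have hM := hMM (e / d) hed
    have hHd := Hh_nonneg' d
    rcases le_or_gt ((d : ℝ) ^ 2) e with hsmall | hlarge
    · -- d ≤ √e : 1 + log (e/d) ≥ L/4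
      have hq : (e : ℝ) / d / 2 ≤ ((e / d : ℕ) : ℝ) := by
        have h1 : (e : ℝ) / d < ((e / d : ℕ) : ℝ) + 1 := by
          have := Nat.lt_floor_add_one ((e : ℝ) / d)
          rwa [Nat.floor_div_natCast, Nat.floor_natCast] at this
        have h2 : (1 : ℝ) ≤ ((e / d : ℕ) : ℝ) := by exact_mod_cast hed
        linarith
      have hq1 : Real.sqrt e / 2 ≤ ((e / d : ℕ) : ℝ) := by
        refine le_trans ?_ hq
        have : Real.sqrt e ≤ (e : ℝ) / d := by
          rw [le_div_iff₀ hd0]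
          have hsd : (d : ℝ) ≤ Real.sqrt e := Real.le_sqrt_of_sq_le hsmall
          calc Real.sqrt e * d ≤ Real.sqrt e * Real.sqrt e :=
                mul_le_mul_of_nonneg_left hsd (Real.sqrt_nonneg _)
            _ = e := Real.mul_self_sqrt he0.le
        linarith
      have hlog : L / 4 ≤ 1 + Real.log ((e / d : ℕ) : ℝ) := by
        have hpos : 0 < Real.sqrt e / 2 := by positivity
        have h1 : Real.log (Real.sqrt e / 2) ≤ Real.log ((e / d : ℕ) : ℝ) :=
          Real.log_le_log hpos hq1
        have h2 : Real.log (Real.sqrt e / 2) = Real.log e / 2 - Real.log 2 := by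
          rw [Real.log_div (by positivity) (by norm_num), Real.log_sqrt he0.le]
        have h3 : Real.log 2 < 0.7 := by
          have := Real.log_two_lt_d9; linarith
        rw [hLdef]; linarith
      have hb : C₁ / (1 + Real.log ((e / d : ℕ) : ℝ)) ^ k ≤ 4 ^ k * C₁ / L ^ k := by
        rw [div_le_div_iff₀ (by positivity) (by positivity)]
        calc C₁ * L ^ k = C₁ * (4 * (L / 4)) ^ k := by ring
          _ = 4 ^ k * C₁ * (L / 4) ^ k := by rw [mul_pow]; ring
          _ ≤ 4 ^ k * C₁ * (1 + Real.log ((e / d : ℕ) : ℝ)) ^ k := by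
              gcongr
      have : Hh d * |∑ j ∈ Icc 1 (e / d), (μ j : ℝ) / j| ≤ Hh d * (4 ^ k * C₁ / L ^ k) :=
        mul_le_mul_of_nonneg_left (hM.trans hb) hHd
      have hextra : 0 ≤ Hh d * (d : ℝ) ^ (1 / 2 : ℝ) * (C₁ * (e : ℝ) ^ (-(1 / 4 : ℝ))) := by positivity
      linarith
    · -- d > √e : bound MM by C₁ ≤ C₁ d^{1/2} e^{-1/4}
      have hM1 : |∑ j ∈ Icc 1 (e / d), (μ j : ℝ) / j| ≤ C₁ := by
        refine hM.trans ?_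
        rw [div_le_iff₀ (by positivity)]
        have : 1 ≤ (1 + Real.log ((e / d : ℕ) : ℝ)) ^ k := one_le_pow₀ (by
          have : 0 ≤ Real.log ((e / d : ℕ) : ℝ) := Real.log_nonneg (by exact_mod_cast hed)
          linarith)
        nlinarith
      have hw : 1 ≤ (d : ℝ) ^ (1 / 2 : ℝ) * (e : ℝ) ^ (-(1 / 4 : ℝ)) := by
        have h1 : (e : ℝ) ^ (1 / 4 : ℝ) ≤ (d : ℝ) ^ (1 / 2 : ℝ) := by
          have : (e : ℝ) ^ (1 / 4 : ℝ) ≤ ((d : ℝ) ^ 2) ^ (1 / 4 : ℝ) :=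
            Real.rpow_le_rpow he0.le hlarge.le (by norm_num)
          refine this.trans (le_of_eq ?_)
          rw [← Real.rpow_natCast, ← Real.rpow_mul hd0.le]; norm_num
        rw [Real.rpow_neg he0.le, ← div_eq_mul_inv, le_div_iff₀ (by positivity), one_mul]
        exact h1
      have : Hh d * |∑ j ∈ Icc 1 (e / d), (μ j : ℝ) / j| ≤
          Hh d * (d : ℝ) ^ (1 / 2 : ℝ) * (C₁ * (e : ℝ) ^ (-(1 / 4 : ℝ))) := by
        calc Hh d * |∑ j ∈ Icc 1 (e / d), (μ j : ℝ) / j| ≤ Hh d * C₁ :=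
              mul_le_mul_of_nonneg_left hM1 hHd
          _ = Hh d * C₁ * 1 := (mul_one _).symm
          _ ≤ Hh d * C₁ * ((d : ℝ) ^ (1 / 2 : ℝ) * (e : ℝ) ^ (-(1 / 4 : ℝ))) :=
              mul_le_mul_of_nonneg_left hw (by positivity)
          _ = Hh d * (d : ℝ) ^ (1 / 2 : ℝ) * (C₁ * (e : ℝ) ^ (-(1 / 4 : ℝ))) := by ring
      have hextra : 0 ≤ Hh d * (4 ^ k * C₁ / L ^ k) := by positivity
      linarith
  refine (Finset.abs_sum_le_sum_abs _ _).trans ((Finset.sum_le_sum hterm).trans ?_)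
  rw [Finset.sum_add_distrib, ← Finset.sum_mul, ← Finset.sum_mul]
  have hA : (∑ d ∈ Icc 1 e, Hh d) * (4 ^ k * C₁ / L ^ k) ≤ π ^ 2 / 6 * (4 ^ k * C₁ / L ^ k) :=
    mul_le_mul_of_nonneg_right (sum_Hh_le _) (by positivity)
  have hB : (∑ d ∈ Icc 1 e, Hh d * (d : ℝ) ^ (1 / 2 : ℝ)) * (C₁ * (e : ℝ) ^ (-(1 / 4 : ℝ))) ≤
      C₂ * (C₁ * (K / L ^ k)) := by
    refine mul_le_mul (hH e) (mul_le_mul_of_nonneg_left (hKb e he1) hC₁.le) (by positivity) hC₂.le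
  have hLk : 0 < L ^ k := by positivity
  calc (∑ d ∈ Icc 1 e, Hh d) * (4 ^ k * C₁ / L ^ k) +
        (∑ d ∈ Icc 1 e, Hh d * (d : ℝ) ^ (1 / 2 : ℝ)) * (C₁ * (e : ℝ) ^ (-(1 / 4 : ℝ)))
      ≤ π ^ 2 / 6 * (4 ^ k * C₁ / L ^ k) + C₂ * (C₁ * (K / L ^ k)) := add_le_add hA hB
    _ = (4 ^ k * C₁ * (π ^ 2 / 6) + C₁ * C₂ * K) / L ^ k := by ring

end Summit.Parity.GeneralizedHardyLittlewood.Theorems.BeyondDiagonalBeatsQuarter.MellinBump
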